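import Literature.MathematicalPhysics.QuantumFieldTheory.OSPointwiseAnalyticity
import Literature.MathematicalPhysics.QuantumFieldTheory.OSAveragedSuperposition
import Mathlib.Analysis.Calculus.BumpFunction.Normed
import Mathlib.MeasureTheory.Integral.Pi
import HarnessLib

/-!
# Point vectors and the pointwise Gram identity (Osterwalder–Schrader II, Ch. V.2, (P₀))

Topic `Literature/MathematicalPhysics/QuantumFieldTheory`; sequel of `OSPointwiseAnalyticity`.
Osterwalder–Schrader II (Comm. Math. Phys. 42 (1975)), Ch. V.2, p. 294, start of the induction:
*"(A₀) follows from the results of Section V.1. We claim that (P₀) follows from (A₀) and (5.2).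
Notice that (5.2) was valid in the sense of distributions only, while (P₀) asserts that it also
holds in the sense of functions, i.e., pointwise. For a proof smear both sides of (5.2) with two
functions `f_ν`, `g_ν`, which as `ν` tends to infinity tend to `δ`-functions and take the limit."*
Here (5.2) is `S_{n+m-1}(f* × 𝒰_s g) = (Ψₙ(f), e^{-sH} Ψₘ(g))` and (P₀) is the existence of the
vectors `Ψₙ(x, ξ)` attached to the *points* of the positive-time ordered region with the Gram
identity `(Ψₙ(x', ξ'), Ψₘ(x, ξ)) = S(θ(x', ξ'), (x, ξ))` (5.17) at `N = 0`. This file carries out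
exactly this δ-sequence argument, from the real analyticity of the Schwinger functions
(`schwinger_exists_realAnalytic_density`, Thm. 4.1):

* `IsUnitBump r ψ` — nonnegative profiles of mass one supported in `B̄(0, r)`; normalised smooth
  bumps (`bumpS`) are such, and so are their reflections;
* `norm_schwinger_cluster_sub_le` — **the approximate identity**: if `𝔖_N` has a continuous
  density `S` near `x`, then `𝔖_N(⊗ⱼ ψⱼ(· − xⱼ)) → S(x)` as the radius of the unit bumps `ψⱼ`
  tends to `0`;
* `pointVector`, `tendsto_apprVec` — **(P₀)**: for a configuration `x` of `m + 1` points with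
  `0 < x⁰_0 < ⋯ < x⁰_m` (`PosOrdered x`) the OS vectors `apprVec n` of the normalised bump clusters
  of radii `x⁰_0/(n+2)` at `x` form a Cauchy sequence (`cauchySeq_apprVec`) and converge in the OS
  Hilbert space to the **point vector** `Ψ(x)`; every other δ-sequence of unit-bump clusters at `x`
  has the same limit (`tendsto_clusterVec_pointVector`);
* `inner_pointVector` — the **pointwise Gram identity**
  `⟪Ψ(x'), Ψ(x)⟫ = S(θx'_{m'}, …, θx'_0, x_0, …, x_m)` for any continuous density `S` of
  `𝔖_{m'+1+(m+1)}` on the configurations with increasing times (`schwinger_exists_density_add`);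
  `shiftH_pointVector` — `e^{-tH} Ψ(x) = Ψ(x + t e₀)` (`t ≥ 0`), whence the semigroup matrix
  elements `⟪Ψ(x'), e^{-tH} Ψ(x)⟫ = S(θx', x + t e₀)` (`inner_pointVector_shiftH`, OS (5.2)
  pointwise).

## References

* K. Osterwalder, R. Schrader, *Axioms for Euclidean Green's functions II*, Comm. Math. Phys.
  42 (1975) 281–305, Ch. V.2 p. 294, (5.2), (5.17)–(5.19). [OsterwalderSchraderCMP1975]
-/

noncomputable section

open MeasureTheory Set Filter Metric
open _root_.Topology
open scoped InnerProductSpace SchwartzMap NNReal ComplexConjugate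

namespace Literature.MathematicalPhysics.QuantumFieldTheory

open Literature.MathematicalPhysics.QuantumLattice (SchwingerFamily IsPositiveTimeMulti)
open Literature.MathematicalPhysics.QuantumLattice.SchwingerFamily
open Literature.MathematicalPhysics.QuantumLattice.SchwingerFamily.OSSpace
open Literature.Analysis.Complex (continuous_mul_of_continuousOn_of_tsupport_subset)

variable {d : ℕ}

/-! ### The continuous density of `𝔖_N` on the ordered region (transport of Thm. 4.1) -/

section Density

variable [NeZero d]

/-- Strictly increasing times, consecutive form. [folklore] -/
theorem strictMono_time_iff {k : ℕ} (x : Fin (k + 2) → EuclideanSpace ℝ (Fin d)) :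
    StrictMono (fun j => x j 0) ↔ ∀ i : Fin (k + 1), x (Fin.castSucc i) 0 < x i.succ 0 :=
  Fin.strictMono_iff_lt_succ

/-- **Theorem 4.1 for `𝔖_N`, `N = k + 2`, in the form used here**: a function `S` continuous on the
configurations with strictly increasing times which is the density of `𝔖_N` near each of them. [cite: OsterwalderSchraderCMP1975, Thm. 4.1] -/
theorem schwinger_exists_density (𝔖 : SchwingerFamily (EuclideanSpace ℝ (Fin d)))
    (hE1 : 𝔖.IsEuclideanCovariant) (hE2 : 𝔖.IsOSReflectionPositive) (hE0 : 𝔖.HasLinearGrowth)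
    {N k : ℕ} (hN : N = k + 2) :
    ∃ S : (Fin N → EuclideanSpace ℝ (Fin d)) → ℂ, ContinuousOn S {x | StrictMono fun j => x j 0} ∧
      ∀ x : Fin N → EuclideanSpace ℝ (Fin d), StrictMono (fun j => x j 0) → ∃ ρ : ℝ, 0 < ρ ∧
        Metric.ball x ρ ⊆ {x | StrictMono fun j => x j 0} ∧
        ∀ F : 𝓢((Fin N → EuclideanSpace ℝ (Fin d)), ℂ),
          tsupport (F : (Fin N → EuclideanSpace ℝ (Fin d)) → ℂ) ⊆ Metric.ball x ρ → 𝔖 N F = ∫ y, S y * F y := by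
  subst hN
  have hset : {x : Fin (k + 2) → EuclideanSpace ℝ (Fin d) | StrictMono fun j => x j 0} = orderedRegion k d := by
    ext x; exact strictMono_time_iff x
  obtain ⟨S, hS, hloc⟩ := schwinger_exists_realAnalytic_density (k := k) 𝔖 hE1 hE2 hE0
  refine ⟨S, by rwa [hset], fun x hx => ?_⟩
  obtain ⟨ρ, hρ, hρU, -, -, -, hrep⟩ := hloc x ((strictMono_time_iff x).1 hx)
  exact ⟨ρ, hρ, by rwa [hset], hrep⟩

/-- **The density of `𝔖_{m'+1+(m+1)}`** (Thm. 4.1, transported along `m' + 1 + (m + 1) = (m' + m) + 2`). [folklore] -/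
theorem schwinger_exists_density_add (𝔖 : SchwingerFamily (EuclideanSpace ℝ (Fin d)))
    (hE1 : 𝔖.IsEuclideanCovariant) (hE2 : 𝔖.IsOSReflectionPositive) (hE0 : 𝔖.HasLinearGrowth) {m' m : ℕ} :
    ∃ S : (Fin (m' + 1 + (m + 1)) → EuclideanSpace ℝ (Fin d)) → ℂ, ContinuousOn S {x | StrictMono fun j => x j 0} ∧
      ∀ x : Fin (m' + 1 + (m + 1)) → EuclideanSpace ℝ (Fin d), StrictMono (fun j => x j 0) → ∃ ρ : ℝ, 0 < ρ ∧
        Metric.ball x ρ ⊆ {x | StrictMono fun j => x j 0} ∧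
        ∀ F : 𝓢((Fin (m' + 1 + (m + 1)) → EuclideanSpace ℝ (Fin d)), ℂ),
          tsupport (F : (Fin (m' + 1 + (m + 1)) → EuclideanSpace ℝ (Fin d)) → ℂ) ⊆ Metric.ball x ρ →
            𝔖 (m' + 1 + (m + 1)) F = ∫ y, S y * F y :=
  schwinger_exists_density 𝔖 hE1 hE2 hE0 (k := m' + m) (by omega)

end Density

/-! ### Unit bumps -/

section Bumps

/-- **Unit bumps of radius `r`**: nonnegative profiles of total mass one supported in `B̄(0, r)`. [folklore] -/
structure IsUnitBump (r : ℝ) (ψ : 𝓢(EuclideanSpace ℝ (Fin d), ℂ)) : Prop where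
  nonneg : ∀ y, ∃ t : ℝ, 0 ≤ t ∧ ψ y = t
  mass : ∫ y, ψ y = 1
  supp : tsupport (ψ : EuclideanSpace ℝ (Fin d) → ℂ) ⊆ Metric.closedBall 0 r

/-- The smooth bump of outer radius `r` about the origin. [folklore] -/
def bumpOf {r : ℝ} (hr : 0 < r) : ContDiffBump (0 : EuclideanSpace ℝ (Fin d)) := ⟨r / 2, r, half_pos hr, half_lt_self hr⟩

/-- The normalised bump has compact support (as a complex function). [folklore] -/
theorem hasCompactSupport_bump_normed {r : ℝ} (hr : 0 < r) :
    HasCompactSupport fun y : EuclideanSpace ℝ (Fin d) => (((bumpOf hr).normed volume y : ℝ) : ℂ) :=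
  (bumpOf hr).hasCompactSupport_normed.comp_left Complex.ofReal_zero

/-- The normalised bump is smooth (as a complex function). [folklore] -/
theorem contDiff_bump_normed {r : ℝ} (hr : 0 < r) :
    ContDiff ℝ (⊤ : ℕ∞) fun y : EuclideanSpace ℝ (Fin d) => (((bumpOf hr).normed volume y : ℝ) : ℂ) :=
  Complex.ofRealCLM.contDiff.comp (bumpOf hr).contDiff_normed

/-- **The normalised smooth bump of radius `r`** as a Schwartz function. [folklore] -/
def bumpS {r : ℝ} (hr : 0 < r) : 𝓢(EuclideanSpace ℝ (Fin d), ℂ) :=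
  (hasCompactSupport_bump_normed hr).toSchwartzMap (contDiff_bump_normed hr)

/-- Values of the normalised bump. [folklore] -/
theorem bumpS_apply {r : ℝ} (hr : 0 < r) (y : EuclideanSpace ℝ (Fin d)) :
    bumpS hr y = (((bumpOf hr).normed volume y : ℝ) : ℂ) := rfl

/-- **The normalised bump is a unit bump.** [folklore] -/
theorem isUnitBump_bumpS {r : ℝ} (hr : 0 < r) : IsUnitBump r (bumpS (d := d) hr) where
  nonneg y := ⟨_, (bumpOf hr).nonneg_normed y, bumpS_apply hr y⟩
  mass := by
    simp_rw [bumpS_apply]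
    have h : ∫ y : EuclideanSpace ℝ (Fin d), (((bumpOf hr).normed volume y : ℝ) : ℂ) =
        ((∫ y, (bumpOf hr).normed volume y : ℝ) : ℂ) := integral_ofReal
    rw [h, (bumpOf hr).integral_normed, Complex.ofReal_one]
  supp := by
    rw [show ((bumpS hr : 𝓢(EuclideanSpace ℝ (Fin d), ℂ)) : EuclideanSpace ℝ (Fin d) → ℂ) =
      Complex.ofReal ∘ (bumpOf hr).normed volume from funext (bumpS_apply hr)]
    refine (closure_mono (Function.support_comp_subset Complex.ofReal_zero _)).trans (le_of_eq ?_)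
    exact (bumpOf hr).tsupport_normed_eq

variable [NeZero d]

/-- **Reflections of unit bumps are unit bumps.** [folklore] -/
theorem isUnitBump_reflectOne {r : ℝ} {ψ : 𝓢(EuclideanSpace ℝ (Fin d), ℂ)} (h : IsUnitBump r ψ) :
    IsUnitBump r (reflectOne ψ) where
  nonneg y := by
    obtain ⟨t, ht, hty⟩ := h.nonneg (QuantumLattice.timeReflection d y)
    exact ⟨t, ht, by rw [reflectOne_apply, hty, Complex.conj_ofReal]⟩
  mass := by
    have hfun : (fun y => reflectOne ψ y) = fun y => conj (ψ (QuantumLattice.timeReflection d y)) :=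
      funext fun y => reflectOne_apply ψ y
    rw [hfun, integral_conj, (QuantumLattice.timeReflection d).measurePreserving.integral_comp
      (QuantumLattice.timeReflection d).toHomeomorph.measurableEmbedding, h.mass, map_one]
  supp := tsupport_reflectOne_subset_ball h.supp

end Bumps

/-! ### Clusters of unit bumps and the approximate identity -/

section Clusters

variable {N : ℕ}

/-- Values of a cluster of profiles: `∏ⱼ ψⱼ(yⱼ − xⱼ)`. [folklore] -/
theorem cluster_apply (ψ : Fin N → 𝓢(EuclideanSpace ℝ (Fin d), ℂ)) (x y : Fin N → EuclideanSpace ℝ (Fin d)) :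
    skeletonFnV (SchwartzMap.tensorFin N ψ) x y = ∏ j, ψ j (y j - x j) := by
  rw [skeletonFnV_apply, SchwartzMap.tensorFin_apply]

/-- Clusters of unit bumps take nonnegative real values. [folklore] -/
theorem cluster_nonneg {r : ℝ} {ψ : Fin N → 𝓢(EuclideanSpace ℝ (Fin d), ℂ)} (hψ : ∀ j, IsUnitBump r (ψ j))
    (x y : Fin N → EuclideanSpace ℝ (Fin d)) :
    ∃ t : ℝ, 0 ≤ t ∧ skeletonFnV (SchwartzMap.tensorFin N ψ) x y = t := by
  choose t ht hty using fun j => (hψ j).nonneg (y j - x j)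
  refine ⟨∏ j, t j, Finset.prod_nonneg fun j _ => ht j, ?_⟩
  rw [cluster_apply, Complex.ofReal_prod]
  exact Finset.prod_congr rfl fun j _ => hty j

/-- The norm of a cluster of unit bumps is its real part. [folklore] -/
theorem norm_cluster_eq_re {r : ℝ} {ψ : Fin N → 𝓢(EuclideanSpace ℝ (Fin d), ℂ)} (hψ : ∀ j, IsUnitBump r (ψ j))
    (x y : Fin N → EuclideanSpace ℝ (Fin d)) :
    ‖skeletonFnV (SchwartzMap.tensorFin N ψ) x y‖ = RCLike.re (skeletonFnV (SchwartzMap.tensorFin N ψ) x y) := by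
  obtain ⟨t, ht, hty⟩ := cluster_nonneg hψ x y
  rw [hty, Complex.norm_real, Real.norm_eq_abs, abs_of_nonneg ht, RCLike.re_to_complex, Complex.ofReal_re]

/-- **Clusters of unit bumps have mass one.** [folklore] -/
theorem integral_cluster {r : ℝ} {ψ : Fin N → 𝓢(EuclideanSpace ℝ (Fin d), ℂ)} (hψ : ∀ j, IsUnitBump r (ψ j))
    (x : Fin N → EuclideanSpace ℝ (Fin d)) :
    ∫ y, skeletonFnV (SchwartzMap.tensorFin N ψ) x y = 1 := by
  simp_rw [cluster_apply]
  have h2 := integral_fin_nat_prod_volume_eq_prod (𝕜 := ℂ) (fun j (z : EuclideanSpace ℝ (Fin d)) => ψ j (z - x j))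
  refine h2.trans ?_
  have h3 : ∀ j : Fin N, ∫ z : EuclideanSpace ℝ (Fin d), ψ j (z - x j) = 1 := fun j => by
    rw [integral_sub_right_eq_self (fun z => ψ j z) (x j), (hψ j).mass]
  simp_rw [h3]
  exact Finset.prod_const_one

/-- **Supports of clusters of unit bumps**: `⊗ⱼ ψⱼ(· − xⱼ)` is supported in `B̄(x, r)`. [folklore] -/
theorem tsupport_cluster_subset {r : ℝ} {ψ : Fin N → 𝓢(EuclideanSpace ℝ (Fin d), ℂ)} (hψ : ∀ j, IsUnitBump r (ψ j))
    (hr : 0 ≤ r) (x : Fin N → EuclideanSpace ℝ (Fin d)) :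
    tsupport (skeletonFnV (SchwartzMap.tensorFin N ψ) x : (Fin N → EuclideanSpace ℝ (Fin d)) → ℂ) ⊆ Metric.closedBall x r := by
  refine closure_minimal (fun y hy => ?_) isClosed_closedBall
  rw [Function.mem_support, cluster_apply] at hy
  rw [Metric.mem_closedBall, dist_pi_le_iff hr]
  intro j
  have hj : ψ j (y j - x j) ≠ 0 := fun h0 => hy (Finset.prod_eq_zero (Finset.mem_univ j) h0)
  have hmem := (hψ j).supp (subset_tsupport _ (Function.mem_support.2 hj))
  rwa [Metric.mem_closedBall, dist_zero_right, ← dist_eq_norm] at hmem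

/-- Clusters of unit bumps have compact support. [folklore] -/
theorem hasCompactSupport_cluster {r : ℝ} {ψ : Fin N → 𝓢(EuclideanSpace ℝ (Fin d), ℂ)} (hψ : ∀ j, IsUnitBump r (ψ j))
    (hr : 0 ≤ r) (x : Fin N → EuclideanSpace ℝ (Fin d)) :
    HasCompactSupport (skeletonFnV (SchwartzMap.tensorFin N ψ) x : (Fin N → EuclideanSpace ℝ (Fin d)) → ℂ) :=
  IsCompact.of_isClosed_subset (isCompact_closedBall x r) (isClosed_tsupport _) (tsupport_cluster_subset hψ hr x)

/-- **The approximate identity** (OS II p. 294: "functions … which tend to δ-functions"): if `𝔖_N`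
has a density `S` on `B(x, ρ)`, continuous there, then for unit bumps `ψⱼ` of radius `r → 0`,
`𝔖_N(⊗ⱼ ψⱼ(· − xⱼ)) → S(x)`; quantitatively, `‖𝔖_N(⊗ⱼ ψⱼ(· − xⱼ)) − S(x)‖ ≤ ε` once `r < r₀(ε)`. [cite: OsterwalderSchraderCMP1975, Ch. V.2 p. 294] -/
theorem norm_schwinger_cluster_sub_le (𝔖 : SchwingerFamily (EuclideanSpace ℝ (Fin d)))
    {S : (Fin N → EuclideanSpace ℝ (Fin d)) → ℂ} {x : Fin N → EuclideanSpace ℝ (Fin d)} {ρ : ℝ} (hρ : 0 < ρ)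
    (hS : ContinuousOn S (Metric.ball x ρ))
    (hrep : ∀ F : 𝓢((Fin N → EuclideanSpace ℝ (Fin d)), ℂ),
      tsupport (F : (Fin N → EuclideanSpace ℝ (Fin d)) → ℂ) ⊆ Metric.ball x ρ → 𝔖 N F = ∫ y, S y * F y)
    {ε : ℝ} (hε : 0 < ε) :
    ∃ r₀ : ℝ, 0 < r₀ ∧ ∀ (r : ℝ) (ψ : Fin N → 𝓢(EuclideanSpace ℝ (Fin d), ℂ)), 0 < r → r < r₀ →
      (∀ j, IsUnitBump r (ψ j)) → ‖𝔖 N (skeletonFnV (SchwartzMap.tensorFin N ψ) x) - S x‖ ≤ ε := by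
  have hx : x ∈ Metric.ball x ρ := mem_ball_self hρ
  have hc : ContinuousAt S x := (hS x hx).continuousAt (isOpen_ball.mem_nhds hx)
  obtain ⟨δ, hδ, hδε⟩ := Metric.continuousAt_iff.1 hc ε hε
  refine ⟨min δ ρ, lt_min hδ hρ, fun r ψ hr hrr hψ => ?_⟩
  set F := skeletonFnV (SchwartzMap.tensorFin N ψ) x with hFdef
  have hball : Metric.closedBall x r ⊆ Metric.ball x ρ := closedBall_subset_ball (hrr.trans_le (min_le_right _ _))
  have hsupp : tsupport (F : (Fin N → EuclideanSpace ℝ (Fin d)) → ℂ) ⊆ Metric.ball x ρ :=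
    (tsupport_cluster_subset hψ hr.le x).trans hball
  have hFc : HasCompactSupport (F : (Fin N → EuclideanSpace ℝ (Fin d)) → ℂ) := hasCompactSupport_cluster hψ hr.le x
  have hFi : Integrable (F : (Fin N → EuclideanSpace ℝ (Fin d)) → ℂ) := F.continuous.integrable_of_hasCompactSupport hFc
  have hSFi : Integrable fun y => S y * F y :=
    (continuous_mul_of_continuousOn_of_tsupport_subset isOpen_ball hS F.continuous hsupp).integrable_of_hasCompactSupport
      hFc.mul_left
  have hF1 : ∫ y, F y = 1 := integral_cluster hψ x
  rw [hrep F hsupp]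
  have hdiff : ∫ y, (S y - S x) * F y = (∫ y, S y * F y) - S x := by
    simp_rw [sub_mul]
    rw [integral_sub hSFi (hFi.const_mul _), integral_const_mul, hF1, mul_one]
  rw [← hdiff]
  have hbound : ∀ y, ‖(S y - S x) * F y‖ ≤ ε * ‖F y‖ := fun y => by
    rw [norm_mul]
    by_cases hy : y ∈ tsupport (F : (Fin N → EuclideanSpace ℝ (Fin d)) → ℂ)
    · have hyδ : dist y x < δ :=
        lt_of_le_of_lt (mem_closedBall.1 (tsupport_cluster_subset hψ hr.le x hy)) (hrr.trans_le (min_le_left _ _))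
      refine mul_le_mul_of_nonneg_right (le_of_lt ?_) (norm_nonneg _)
      rw [← dist_eq_norm]
      exact hδε hyδ
    · rw [image_eq_zero_of_notMem_tsupport hy, norm_zero, mul_zero, mul_zero]
  have hnormF : ∫ y, ‖F y‖ = 1 := by
    simp_rw [hFdef, norm_cluster_eq_re hψ x]
    rw [integral_re hFi, hF1]
    simp
  calc ‖∫ y, (S y - S x) * F y‖ ≤ ∫ y, ε * ‖F y‖ :=
        norm_integral_le_of_norm_le (hFi.norm.const_mul ε) (Eventually.of_forall hbound)
    _ = ε := by rw [integral_const_mul, hnormF, mul_one]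

end Clusters

/-! ### Configurations with positive increasing times and their Gram configurations -/

section Config

variable [NeZero d] {m m' : ℕ}

/-- **Positive-time ordered configurations**: `0 < x⁰_0 < x⁰_1 < ⋯ < x⁰_m`. [folklore] -/
def PosOrdered (x : Fin (m + 1) → EuclideanSpace ℝ (Fin d)) : Prop :=
  0 < x 0 0 ∧ StrictMono fun j => x j 0

/-- All times of a positive-time ordered configuration are at least the first one. [folklore] -/
theorem PosOrdered.first_le {x : Fin (m + 1) → EuclideanSpace ℝ (Fin d)} (hx : PosOrdered x) (j : Fin (m + 1)) :
    x 0 0 ≤ x j 0 :=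
  hx.2.monotone (Fin.zero_le j)

/-- Time translation by `t ≥ 0` preserves positive-time order. [folklore] -/
theorem PosOrdered.add_timeVec {x : Fin (m + 1) → EuclideanSpace ℝ (Fin d)} (hx : PosOrdered x) {t : ℝ} (ht : 0 ≤ t) :
    PosOrdered fun j => x j + timeVec t := by
  refine ⟨?_, fun i j hij => ?_⟩
  · simp only [PiLp.add_apply, timeVec, PiLp.single_apply, if_true]
    linarith [hx.1]
  · simp only [PiLp.add_apply]
    have h := hx.2 hij
    simp only at h
    linarith

/-- **The Gram configuration** `(θx'_{m'}, …, θx'_0, x_0, …, x_m)` of `m' + 1 + (m + 1)` points. [cite: OsterwalderSchraderCMP1975, Ch. V.2 (5.17)] -/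
def gramConfig (x' : Fin (m' + 1) → EuclideanSpace ℝ (Fin d)) (x : Fin (m + 1) → EuclideanSpace ℝ (Fin d)) :
    Fin (m' + 1 + (m + 1)) → EuclideanSpace ℝ (Fin d) :=
  Fin.append (fun j => QuantumLattice.timeReflection d (x' (Fin.rev j))) x

/-- **The Gram configuration of two positive-time ordered configurations has strictly increasing
times** `−x'⁰_{m'} < ⋯ < −x'⁰_0 < x⁰_0 < ⋯ < x⁰_m`. [folklore] -/
theorem strictMono_gramConfig {x' : Fin (m' + 1) → EuclideanSpace ℝ (Fin d)} {x : Fin (m + 1) → EuclideanSpace ℝ (Fin d)}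
    (hx' : PosOrdered x') (hx : PosOrdered x) : StrictMono fun j => gramConfig x' x j 0 := by
  intro i j hij
  simp only [gramConfig]
  induction i using Fin.addCases with
  | left i =>
    induction j using Fin.addCases with
    | left j =>
      rw [Fin.append_left, Fin.append_left, QuantumLattice.timeReflection_apply, QuantumLattice.timeReflection_apply]
      simp only [if_true]
      have hij' : Fin.rev j < Fin.rev i := by
        rw [Fin.rev_lt_rev]
        exact hij
      linarith [hx'.2 hij']
    | right j =>
      rw [Fin.append_left, Fin.append_right, QuantumLattice.timeReflection_apply]
      simp only [if_true]
      linarith [hx'.1, hx'.first_le (Fin.rev i), hx.1, hx.first_le j]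
  | right i =>
    induction j using Fin.addCases with
    | left j =>
      exfalso
      have h1 : (Fin.natAdd (m' + 1) i : Fin (m' + 1 + (m + 1))).val < (Fin.castAdd (m + 1) j).val := hij
      simp only [Fin.val_natAdd, Fin.val_castAdd] at h1
      omega
    | right j =>
      rw [Fin.append_right, Fin.append_right]
      have hij' : i < j := by
        have h1 : (Fin.natAdd (m' + 1) i : Fin (m' + 1 + (m + 1))).val < (Fin.natAdd (m' + 1) j).val := hij
        simp only [Fin.val_natAdd] at h1
        exact Fin.lt_def.2 (by omega)
      exact hx.2 hij'

omit [NeZero d] in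
/-- Unit bumps of a smaller radius are unit bumps of a larger radius. [folklore] -/
theorem IsUnitBump.mono {r r' : ℝ} {ψ : 𝓢(EuclideanSpace ℝ (Fin d), ℂ)} (h : IsUnitBump r ψ) (hrr' : r ≤ r') :
    IsUnitBump r' ψ :=
  ⟨h.nonneg, h.mass, h.supp.trans (Metric.closedBall_subset_closedBall hrr')⟩

/-- **The Gram function of two clusters is the cluster at the Gram configuration**:
`Θ(⊗ψ'(· − x'))* ⊗ (⊗ψ(· − x)) = ⊗(θψ'_rev, ψ)(· − gramConfig x' x)`. [folklore] -/
theorem osAdjoint_appendTensor_cluster (ψ' : Fin (m' + 1) → 𝓢(EuclideanSpace ℝ (Fin d), ℂ))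
    (ψ : Fin (m + 1) → 𝓢(EuclideanSpace ℝ (Fin d), ℂ)) (x' : Fin (m' + 1) → EuclideanSpace ℝ (Fin d))
    (x : Fin (m + 1) → EuclideanSpace ℝ (Fin d)) :
    (QuantumLattice.osAdjoint (skeletonFnV (SchwartzMap.tensorFin (m' + 1) ψ') x')).appendTensor
        (skeletonFnV (SchwartzMap.tensorFin (m + 1) ψ) x) =
      skeletonFnV (SchwartzMap.tensorFin (m' + 1 + (m + 1)) (Fin.append (fun j => reflectOne (ψ' (Fin.rev j))) ψ))
        (gramConfig x' x) := by
  rw [osAdjoint_skeletonFnV_tensorFin, appendTensor_skeletonFnV_tensorFin]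
  rfl

/-- The profiles of the Gram cluster are unit bumps of the larger radius. [folklore] -/
theorem isUnitBump_append {r r' : ℝ} {ψ' : Fin (m' + 1) → 𝓢(EuclideanSpace ℝ (Fin d), ℂ)}
    {ψ : Fin (m + 1) → 𝓢(EuclideanSpace ℝ (Fin d), ℂ)} (hψ' : ∀ j, IsUnitBump r' (ψ' j)) (hψ : ∀ j, IsUnitBump r (ψ j))
    (J : Fin (m' + 1 + (m + 1))) :
    IsUnitBump (max r' r) (Fin.append (fun j => reflectOne (ψ' (Fin.rev j))) ψ J) := by
  induction J using Fin.addCases with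
  | left j => rw [Fin.append_left]; exact (isUnitBump_reflectOne (hψ' _)).mono (le_max_left _ _)
  | right j => rw [Fin.append_right]; exact (hψ j).mono (le_max_right _ _)

end Config

/-! ### OS vectors of clusters and their inner products -/

section ClusterVectors

variable [NeZero d] {𝔖 : SchwingerFamily (EuclideanSpace ℝ (Fin d))} (hE2 : 𝔖.IsOSReflectionPositive) {m m' : ℕ}

/-- **Clusters of unit bumps of radius `r < x⁰_0` at a positive-time ordered configuration are
positive-time.** [folklore] -/
theorem isPositiveTimeMulti_cluster {x : Fin (m + 1) → EuclideanSpace ℝ (Fin d)} (hx : PosOrdered x) {r : ℝ}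
    {ψ : Fin (m + 1) → 𝓢(EuclideanSpace ℝ (Fin d), ℂ)} (hψ : ∀ j, IsUnitBump r (ψ j)) (hr : r < x 0 0) :
    IsPositiveTimeMulti (skeletonFnV (SchwartzMap.tensorFin (m + 1) ψ) x) :=
  isPositiveTimeMulti_skeletonFnV_tensorFin (fun j => slab_of_ball (hψ j).supp) fun j => hr.trans_le (hx.first_le j)

/-- **Inner products of cluster vectors are Schwinger functions of Gram clusters**:
`⟪v(⊗ψ'(· − x')), v(⊗ψ(· − x))⟫ = 𝔖_{m'+1+(m+1)}(⊗(θψ'_rev, ψ)(· − gramConfig x' x))`. [cite: OsterwalderSchraderCMP1975, Ch. V.2 (5.2)] -/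
theorem inner_clusterVec {x' : Fin (m' + 1) → EuclideanSpace ℝ (Fin d)} {x : Fin (m + 1) → EuclideanSpace ℝ (Fin d)}
    {ψ' : Fin (m' + 1) → 𝓢(EuclideanSpace ℝ (Fin d), ℂ)} {ψ : Fin (m + 1) → 𝓢(EuclideanSpace ℝ (Fin d), ℂ)}
    (h' : IsPositiveTimeMulti (skeletonFnV (SchwartzMap.tensorFin (m' + 1) ψ') x'))
    (h : IsPositiveTimeMulti (skeletonFnV (SchwartzMap.tensorFin (m + 1) ψ) x)) :
    ⟪ι 𝔖 hE2 (δ 𝔖 hE2 (mkGen _ h')), ι 𝔖 hE2 (δ 𝔖 hE2 (mkGen _ h))⟫_ℂ =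
      𝔖 (m' + 1 + (m + 1)) (skeletonFnV (SchwartzMap.tensorFin (m' + 1 + (m + 1))
        (Fin.append (fun j => reflectOne (ψ' (Fin.rev j))) ψ)) (gramConfig x' x)) := by
  rw [inner_ι_δ_mkGen, pairingRightCLM_apply, osAdjoint_appendTensor_cluster]

end ClusterVectors

/-! ### A Hilbert-space lemma: vectors with nearly equal Gram entries are close -/

section Hilbert

variable {H : Type*} [NormedAddCommGroup H] [InnerProductSpace ℂ H]

/-- If `⟪a, a⟫`, `⟪a, b⟫`, `⟪b, b⟫` are all within `ε` of one number `s`, then `‖a − b‖² ≤ 4ε`. [folklore] -/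
theorem norm_sub_sq_le_of_inner_near (a b : H) (s : ℂ) {ε : ℝ} (haa : ‖⟪a, a⟫_ℂ - s‖ ≤ ε)
    (hab : ‖⟪a, b⟫_ℂ - s‖ ≤ ε) (hbb : ‖⟪b, b⟫_ℂ - s‖ ≤ ε) : ‖a - b‖ ^ 2 ≤ 4 * ε := by
  have h1 : ‖a - b‖ ^ 2 = (⟪a, a⟫_ℂ - s).re - 2 * (⟪a, b⟫_ℂ - s).re + (⟪b, b⟫_ℂ - s).re := by
    rw [@norm_sub_sq ℂ, ← @inner_self_eq_norm_sq ℂ, ← @inner_self_eq_norm_sq ℂ]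
    simp only [Complex.sub_re, RCLike.re_to_complex]
    ring
  rw [h1]
  have e1 := (Complex.abs_re_le_norm (⟪a, a⟫_ℂ - s)).trans haa
  have e2 := (Complex.abs_re_le_norm (⟪a, b⟫_ℂ - s)).trans hab
  have e3 := (Complex.abs_re_le_norm (⟪b, b⟫_ℂ - s)).trans hbb
  rw [abs_le] at e1 e2 e3
  linarith [e1.2, e2.1, e3.2]

omit [InnerProductSpace ℂ H] in
/-- From a bound on the square of the norm to a strict bound on the norm. [folklore] -/
theorem norm_lt_of_sq_le {v : H} {ε δ : ℝ} (hε : 0 < ε) (h : ‖v‖ ^ 2 ≤ δ) (hδ : δ < ε ^ 2) : ‖v‖ < ε :=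
  lt_of_pow_lt_pow_left₀ 2 hε.le (h.trans_lt hδ)

end Hilbert

/-! ### Point vectors -/

section PointVectors

variable [NeZero d] {𝔖 : SchwingerFamily (EuclideanSpace ℝ (Fin d))} (hE2 : 𝔖.IsOSReflectionPositive) {m m' : ℕ}

/-- The radii `x⁰_0 / (n + 2)` of the approximating clusters. [folklore] -/
def apprRadius (x : Fin (m + 1) → EuclideanSpace ℝ (Fin d)) (n : ℕ) : ℝ := x 0 0 / (n + 2)

/-- The radii are positive. [folklore] -/
theorem apprRadius_pos {x : Fin (m + 1) → EuclideanSpace ℝ (Fin d)} (hx : PosOrdered x) (n : ℕ) : 0 < apprRadius x n := by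
  unfold apprRadius; have := hx.1; positivity

/-- The radii are smaller than the first time. [folklore] -/
theorem apprRadius_lt {x : Fin (m + 1) → EuclideanSpace ℝ (Fin d)} (hx : PosOrdered x) (n : ℕ) : apprRadius x n < x 0 0 := by
  unfold apprRadius
  rw [div_lt_iff₀ (by positivity)]
  have := hx.1
  nlinarith

/-- The radii decrease. [folklore] -/
theorem apprRadius_le {x : Fin (m + 1) → EuclideanSpace ℝ (Fin d)} (hx : PosOrdered x) {N n : ℕ} (h : N ≤ n) :
    apprRadius x n ≤ apprRadius x N := by
  unfold apprRadius
  exact div_le_div_of_nonneg_left hx.1.le (by positivity) (by exact_mod_cast Nat.add_le_add_right h 2)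

/-- The radii tend to `0`. [folklore] -/
theorem tendsto_apprRadius (x : Fin (m + 1) → EuclideanSpace ℝ (Fin d)) : Tendsto (apprRadius x) atTop (𝓝 0) := by
  unfold apprRadius
  have h : Tendsto (fun n : ℕ => ((n : ℝ) + 2)⁻¹) atTop (𝓝 0) := by
    have h1 : Tendsto (fun n : ℕ => (n : ℝ) + 2) atTop atTop := tendsto_natCast_atTop_atTop.atTop_add tendsto_const_nhds
    exact tendsto_inv_atTop_zero.comp h1
  simpa [div_eq_mul_inv] using h.const_mul (x 0 0)

/-- Eventually the radii are below any positive threshold. [folklore] -/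
theorem exists_apprRadius_lt (x : Fin (m + 1) → EuclideanSpace ℝ (Fin d)) {r₀ : ℝ} (hr₀ : 0 < r₀) :
    ∃ N : ℕ, ∀ n, N ≤ n → apprRadius x n < r₀ := by
  obtain ⟨N, hN⟩ := ((tendsto_apprRadius x).eventually (gt_mem_nhds hr₀)).exists_forall_of_atTop
  exact ⟨N, hN⟩

/-- **The approximating clusters** `⊗ⱼ b_{r_n}(· − xⱼ)` with normalised bumps of radius `r_n`. [folklore] -/
def apprCluster (x : Fin (m + 1) → EuclideanSpace ℝ (Fin d)) (hx : PosOrdered x) (n : ℕ) :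
    𝓢((Fin (m + 1) → EuclideanSpace ℝ (Fin d)), ℂ) :=
  skeletonFnV (SchwartzMap.tensorFin (m + 1) fun _ => bumpS (apprRadius_pos hx n)) x

/-- The approximating clusters are positive-time. [folklore] -/
theorem isPositiveTimeMulti_apprCluster {x : Fin (m + 1) → EuclideanSpace ℝ (Fin d)} (hx : PosOrdered x) (n : ℕ) :
    IsPositiveTimeMulti (apprCluster x hx n) :=
  isPositiveTimeMulti_cluster hx (fun _ => isUnitBump_bumpS _) (apprRadius_lt hx n)

/-- **The approximating vectors** `v_n(x) = [⊗ⱼ b_{r_n}(· − xⱼ)]` in the OS Hilbert space. [cite: OsterwalderSchraderCMP1975, Ch. V.2 p. 294] -/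
def apprVec (x : Fin (m + 1) → EuclideanSpace ℝ (Fin d)) (hx : PosOrdered x) (n : ℕ) : OSHilbert 𝔖 hE2 :=
  ι 𝔖 hE2 (δ 𝔖 hE2 (mkGen (apprCluster x hx n) (isPositiveTimeMulti_apprCluster hx n)))

/-- **Gram control**: if `𝔖_{m'+1+(m+1)}` has a continuous density `S` near the Gram configuration
of `x'` and `x`, then the inner products of cluster vectors of small radii at `x'` and `x` are close
to `S(gramConfig x' x)`. [folklore] -/
theorem exists_radius_inner_clusterVec_near {x' : Fin (m' + 1) → EuclideanSpace ℝ (Fin d)}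
    {x : Fin (m + 1) → EuclideanSpace ℝ (Fin d)} (hx' : PosOrdered x') (hx : PosOrdered x)
    {S : (Fin (m' + 1 + (m + 1)) → EuclideanSpace ℝ (Fin d)) → ℂ} {ρ : ℝ} (hρ : 0 < ρ)
    (hS : ContinuousOn S (Metric.ball (gramConfig x' x) ρ))
    (hrep : ∀ F : 𝓢((Fin (m' + 1 + (m + 1)) → EuclideanSpace ℝ (Fin d)), ℂ),
      tsupport (F : (Fin (m' + 1 + (m + 1)) → EuclideanSpace ℝ (Fin d)) → ℂ) ⊆ Metric.ball (gramConfig x' x) ρ →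
        𝔖 (m' + 1 + (m + 1)) F = ∫ y, S y * F y)
    {ε : ℝ} (hε : 0 < ε) :
    ∃ r₀ : ℝ, 0 < r₀ ∧ ∀ (r' r : ℝ) (ψ' : Fin (m' + 1) → 𝓢(EuclideanSpace ℝ (Fin d), ℂ))
      (ψ : Fin (m + 1) → 𝓢(EuclideanSpace ℝ (Fin d), ℂ)) (hψ' : ∀ j, IsUnitBump r' (ψ' j)) (hψ : ∀ j, IsUnitBump r (ψ j))
      (hp' : r' < x' 0 0) (hp : r < x 0 0), 0 < r' → 0 < r → r' < r₀ → r < r₀ →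
      ‖⟪ι 𝔖 hE2 (δ 𝔖 hE2 (mkGen _ (isPositiveTimeMulti_cluster hx' hψ' hp'))),
          ι 𝔖 hE2 (δ 𝔖 hE2 (mkGen _ (isPositiveTimeMulti_cluster hx hψ hp)))⟫_ℂ - S (gramConfig x' x)‖ ≤ ε := by
  obtain ⟨r₀, hr₀, h⟩ := norm_schwinger_cluster_sub_le 𝔖 hρ hS hrep hε
  refine ⟨r₀, hr₀, fun r' r ψ' ψ hψ' hψ hp' hp h0' h0 hr' hr => ?_⟩
  rw [inner_clusterVec]
  exact h (max r' r) _ (lt_max_of_lt_left h0') (max_lt hr' hr) (isUnitBump_append hψ' hψ)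

variable (hE1 : 𝔖.IsEuclideanCovariant) (hE0 : 𝔖.HasLinearGrowth)
include hE1 hE0

/-- **The approximating vectors form a Cauchy sequence** (`‖v_n − v_{n'}‖² → 0` because all Gram
entries tend to `S_{2m+2}(gramConfig x x)`). [cite: OsterwalderSchraderCMP1975, Ch. V.2 p. 294] -/
theorem cauchySeq_apprVec {x : Fin (m + 1) → EuclideanSpace ℝ (Fin d)} (hx : PosOrdered x) :
    CauchySeq (apprVec hE2 x hx) := by
  obtain ⟨S, hS, hloc⟩ := schwinger_exists_density_add 𝔖 hE1 hE2 hE0 (m' := m) (m := m)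
  obtain ⟨ρ, hρ, hρU, hrep⟩ := hloc _ (strictMono_gramConfig hx hx)
  refine Metric.cauchySeq_iff.2 fun ε hε => ?_
  have hε' : 0 < ε ^ 2 / 8 := by positivity
  obtain ⟨r₀, hr₀, hnear⟩ := exists_radius_inner_clusterVec_near hE2 hx hx hρ (hS.mono hρU) hrep hε'
  obtain ⟨N, hN⟩ := exists_apprRadius_lt x hr₀
  refine ⟨N, fun n hn n' hn' => ?_⟩
  rw [dist_eq_norm]
  have h := fun (a b : ℕ) (ha : N ≤ a) (hb : N ≤ b) => hnear (apprRadius x a) (apprRadius x b) _ _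
    (fun _ => isUnitBump_bumpS (apprRadius_pos hx a)) (fun _ => isUnitBump_bumpS (apprRadius_pos hx b))
    (apprRadius_lt hx a) (apprRadius_lt hx b) (apprRadius_pos hx a) (apprRadius_pos hx b) (hN a ha) (hN b hb)
  have hsq := norm_sub_sq_le_of_inner_near (apprVec hE2 x hx n) (apprVec hE2 x hx n') (S (gramConfig x x))
    (h n n hn hn) (h n n' hn hn') (h n' n' hn' hn')
  exact norm_lt_of_sq_le hε hsq (by nlinarith)

/-- **The point vector** `Ψ(x) = limₙ v_n(x)` of a positive-time ordered configuration. [cite: OsterwalderSchraderCMP1975, Ch. V.2 (5.17)–(5.19), (P₀)] -/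
def pointVector (x : Fin (m + 1) → EuclideanSpace ℝ (Fin d)) (hx : PosOrdered x) : OSHilbert 𝔖 hE2 :=
  limUnder atTop (apprVec hE2 x hx)

/-- The approximating vectors converge to the point vector. [folklore] -/
theorem tendsto_apprVec {x : Fin (m + 1) → EuclideanSpace ℝ (Fin d)} (hx : PosOrdered x) :
    Tendsto (apprVec hE2 x hx) atTop (𝓝 (pointVector hE2 x hx)) :=
  tendsto_nhds_limUnder (cauchySeq_tendsto_of_complete (cauchySeq_apprVec hE2 hE1 hE0 hx))

/-- **Every sequence of cluster vectors with radii `→ 0` converges to the point vector** (the limit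
does not depend on the δ-sequence). [folklore] -/
theorem tendsto_clusterVec_pointVector {x : Fin (m + 1) → EuclideanSpace ℝ (Fin d)} (hx : PosOrdered x)
    {s : ℕ → ℝ} {ψ : ℕ → Fin (m + 1) → 𝓢(EuclideanSpace ℝ (Fin d), ℂ)} (hψ : ∀ n j, IsUnitBump (s n) (ψ n j))
    (hs0 : ∀ n, 0 < s n) (hsx : ∀ n, s n < x 0 0) (hs : Tendsto s atTop (𝓝 0)) :
    Tendsto (fun n => ι 𝔖 hE2 (δ 𝔖 hE2 (mkGen _ (isPositiveTimeMulti_cluster hx (hψ n) (hsx n))))) atTop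
      (𝓝 (pointVector hE2 x hx)) := by
  set u : ℕ → OSHilbert 𝔖 hE2 := fun n => ι 𝔖 hE2 (δ 𝔖 hE2 (mkGen _ (isPositiveTimeMulti_cluster hx (hψ n) (hsx n)))) with hu
  have hv := tendsto_apprVec hE2 hE1 hE0 hx
  -- `u n − v n → 0`
  have h0 : Tendsto (fun n => u n - apprVec hE2 x hx n) atTop (𝓝 0) := by
    obtain ⟨S, hS, hloc⟩ := schwinger_exists_density_add 𝔖 hE1 hE2 hE0 (m' := m) (m := m)
    obtain ⟨ρ, hρ, hρU, hrep⟩ := hloc _ (strictMono_gramConfig hx hx)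
    refine Metric.tendsto_atTop.2 fun ε hε => ?_
    have hε' : 0 < ε ^ 2 / 8 := by positivity
    obtain ⟨r₀, hr₀, hnear⟩ := exists_radius_inner_clusterVec_near hE2 hx hx hρ (hS.mono hρU) hrep hε'
    obtain ⟨N₁, hN₁⟩ := exists_apprRadius_lt x hr₀
    obtain ⟨N₂, hN₂⟩ := (hs.eventually (gt_mem_nhds hr₀)).exists_forall_of_atTop
    refine ⟨max N₁ N₂, fun n hn => ?_⟩
    have hn₁ : N₁ ≤ n := le_of_max_le_left hn
    have hn₂ : N₂ ≤ n := le_of_max_le_right hn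
    rw [dist_zero_right]
    have huu := hnear (s n) (s n) (ψ n) (ψ n) (hψ n) (hψ n) (hsx n) (hsx n) (hs0 n) (hs0 n) (hN₂ n hn₂) (hN₂ n hn₂)
    have huv := hnear (s n) (apprRadius x n) (ψ n) _ (hψ n) (fun _ => isUnitBump_bumpS (apprRadius_pos hx n))
      (hsx n) (apprRadius_lt hx n) (hs0 n) (apprRadius_pos hx n) (hN₂ n hn₂) (hN₁ n hn₁)
    have hvv := hnear (apprRadius x n) (apprRadius x n) _ _ (fun _ => isUnitBump_bumpS (apprRadius_pos hx n))
      (fun _ => isUnitBump_bumpS (apprRadius_pos hx n)) (apprRadius_lt hx n) (apprRadius_lt hx n)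
      (apprRadius_pos hx n) (apprRadius_pos hx n) (hN₁ n hn₁) (hN₁ n hn₁)
    have hsq := norm_sub_sq_le_of_inner_near (u n) (apprVec hE2 x hx n) (S (gramConfig x x)) huu huv hvv
    exact norm_lt_of_sq_le hε hsq (by nlinarith)
  have h := h0.add hv
  simp only [sub_add_cancel, zero_add] at h
  exact h

/-- **The pointwise Gram identity (P₀)**: for positive-time ordered `x'`, `x` and any continuous
density `S` of `𝔖_{m'+1+(m+1)}` on the configurations with increasing times (Thm. 4.1),
`⟪Ψ(x'), Ψ(x)⟫ = S(θx'_{m'}, …, θx'_0, x_0, …, x_m)`. [cite: OsterwalderSchraderCMP1975, Ch. V.2 (5.17), (P₀)] -/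
theorem inner_pointVector {x' : Fin (m' + 1) → EuclideanSpace ℝ (Fin d)} {x : Fin (m + 1) → EuclideanSpace ℝ (Fin d)}
    (hx' : PosOrdered x') (hx : PosOrdered x)
    {S : (Fin (m' + 1 + (m + 1)) → EuclideanSpace ℝ (Fin d)) → ℂ} (hS : ContinuousOn S {y | StrictMono fun j => y j 0})
    (hrep : ∀ y : Fin (m' + 1 + (m + 1)) → EuclideanSpace ℝ (Fin d), StrictMono (fun j => y j 0) → ∃ ρ : ℝ, 0 < ρ ∧
      Metric.ball y ρ ⊆ {y | StrictMono fun j => y j 0} ∧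
      ∀ F : 𝓢((Fin (m' + 1 + (m + 1)) → EuclideanSpace ℝ (Fin d)), ℂ),
        tsupport (F : (Fin (m' + 1 + (m + 1)) → EuclideanSpace ℝ (Fin d)) → ℂ) ⊆ Metric.ball y ρ →
          𝔖 (m' + 1 + (m + 1)) F = ∫ z, S z * F z) :
    ⟪pointVector hE2 x' hx', pointVector hE2 x hx⟫_ℂ = S (gramConfig x' x) := by
  obtain ⟨ρ, hρ, hρU, hrepG⟩ := hrep _ (strictMono_gramConfig hx' hx)
  have hlim := Filter.Tendsto.inner (𝕜 := ℂ) (tendsto_apprVec hE2 hE1 hE0 hx') (tendsto_apprVec hE2 hE1 hE0 hx)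
  refine tendsto_nhds_unique hlim (Metric.tendsto_atTop.2 fun ε hε => ?_)
  obtain ⟨r₀, hr₀, hnear⟩ := exists_radius_inner_clusterVec_near hE2 hx' hx hρ (hS.mono hρU) hrepG (half_pos hε)
  obtain ⟨N₁, hN₁⟩ := exists_apprRadius_lt x' hr₀
  obtain ⟨N₂, hN₂⟩ := exists_apprRadius_lt x hr₀
  refine ⟨max N₁ N₂, fun n hn => ?_⟩
  rw [dist_eq_norm]
  refine lt_of_le_of_lt (hnear _ _ _ _ (fun _ => isUnitBump_bumpS (apprRadius_pos hx' n))
    (fun _ => isUnitBump_bumpS (apprRadius_pos hx n)) (apprRadius_lt hx' n) (apprRadius_lt hx n)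
    (apprRadius_pos hx' n) (apprRadius_pos hx n) (hN₁ n (le_of_max_le_left hn)) (hN₂ n (le_of_max_le_right hn))) ?_
  linarith

/-- **The semigroup translates the point vectors**: `e^{-tH} Ψ(x) = Ψ(x + t e₀)` for `t ≥ 0`. [cite: OsterwalderSchraderCMP1975, Ch. V.2 (5.2), (5.17)] -/
theorem shiftH_pointVector {x : Fin (m + 1) → EuclideanSpace ℝ (Fin d)} (hx : PosOrdered x) {t : ℝ} (ht : 0 ≤ t) :
    shiftH hE2 t (pointVector hE2 x hx) = pointVector hE2 (fun j => x j + timeVec t) (hx.add_timeVec ht) := by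
  have hxt : PosOrdered fun j => x j + timeVec t := hx.add_timeVec ht
  have hsx : ∀ n, apprRadius x n < (x 0 + timeVec t : EuclideanSpace ℝ (Fin d)) 0 := fun n => by
    have h1 := apprRadius_lt hx n
    have h2 : (x 0 + timeVec t : EuclideanSpace ℝ (Fin d)) 0 = x 0 0 + t := by simp [timeVec]
    rw [h2]
    linarith
  -- the translated approximating vectors converge to `Ψ(x + t e₀)`
  have hlim := tendsto_clusterVec_pointVector hE2 hE1 hE0 hxt (s := apprRadius x)
    (ψ := fun n _ => bumpS (apprRadius_pos hx n)) (fun n _ => isUnitBump_bumpS (apprRadius_pos hx n))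
    (apprRadius_pos hx) hsx (tendsto_apprRadius x)
  -- and they are the images of the approximating vectors of `x`
  have heq : ∀ n, shiftH hE2 t (apprVec hE2 x hx n) =
      ι 𝔖 hE2 (δ 𝔖 hE2 (mkGen _ (isPositiveTimeMulti_cluster hxt (fun _ => isUnitBump_bumpS (apprRadius_pos hx n)) (hsx n)))) := by
    intro n
    rw [apprVec, shiftH_ι_δ_mkGen hE1 hE2 (apprCluster x hx n) (isPositiveTimeMulti_apprCluster hx n) ht]
    have hp : mkGen (QuantumLattice.translateMulti (timeVec t) (apprCluster x hx n))
        (isPositiveTimeMulti_translate (isPositiveTimeMulti_apprCluster hx n) ht) =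
        mkGen _ (isPositiveTimeMulti_cluster hxt (fun _ => isUnitBump_bumpS (apprRadius_pos hx n)) (hsx n)) :=
      Sigma.ext rfl (heq_of_eq (Subtype.ext (translateMulti_skeletonFnV _ _ _)))
    rw [hp]
  have hlim' : Tendsto (fun n => shiftH hE2 t (apprVec hE2 x hx n)) atTop (𝓝 (shiftH hE2 t (pointVector hE2 x hx))) :=
    ((shiftH hE2 t).continuous.tendsto _).comp (tendsto_apprVec hE2 hE1 hE0 hx)
  simp_rw [heq] at hlim'
  exact tendsto_nhds_unique hlim' hlim

/-- **The semigroup matrix elements of the point vectors (OS (5.2) pointwise)**: for `t ≥ 0`,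
`⟪Ψ(x'), e^{-tH} Ψ(x)⟫ = S(θx'_{m'}, …, θx'_0, x_0 + t e₀, …, x_m + t e₀)`. [cite: OsterwalderSchraderCMP1975, Ch. V.2 (5.2), (5.17)] -/
theorem inner_pointVector_shiftH {x' : Fin (m' + 1) → EuclideanSpace ℝ (Fin d)} {x : Fin (m + 1) → EuclideanSpace ℝ (Fin d)}
    (hx' : PosOrdered x') (hx : PosOrdered x) {t : ℝ} (ht : 0 ≤ t)
    {S : (Fin (m' + 1 + (m + 1)) → EuclideanSpace ℝ (Fin d)) → ℂ} (hS : ContinuousOn S {y | StrictMono fun j => y j 0})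
    (hrep : ∀ y : Fin (m' + 1 + (m + 1)) → EuclideanSpace ℝ (Fin d), StrictMono (fun j => y j 0) → ∃ ρ : ℝ, 0 < ρ ∧
      Metric.ball y ρ ⊆ {y | StrictMono fun j => y j 0} ∧
      ∀ F : 𝓢((Fin (m' + 1 + (m + 1)) → EuclideanSpace ℝ (Fin d)), ℂ),
        tsupport (F : (Fin (m' + 1 + (m + 1)) → EuclideanSpace ℝ (Fin d)) → ℂ) ⊆ Metric.ball y ρ →
          𝔖 (m' + 1 + (m + 1)) F = ∫ z, S z * F z) :
    ⟪pointVector hE2 x' hx', shiftH hE2 t (pointVector hE2 x hx)⟫_ℂ =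
      S (gramConfig x' fun j => x j + timeVec t) := by
  rw [shiftH_pointVector hE2 hE1 hE0 hx ht]
  exact inner_pointVector hE2 hE1 hE0 hx' (hx.add_timeVec ht) hS hrep

end PointVectors

end Literature.MathematicalPhysics.QuantumFieldTheory
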